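import Summits.Ventures.CertifiedManyBodySolver.Observables.PairLROTorusDictionary
import HarnessLib

/-!
# The window certificate for the box pair word bounds the SUMMIT's pair-field LRO functional on the
# tori themselves (part 2 of 2): certificate (λ-form, `λ < 0`) ⇒ finite-torus ceiling with slack ⇒
# `liminf_k |Λ_{2k}|⁻² Σ_{x,y} P_d(2k; x, y) ≤ (hi − E_cert + Σ‖aₖ‖ − (Σμ)(n/2 − ν)) / ((−λ)|B|²)`

HONEST FRAMING: first certified bounds on pairing observables; not a superconductivity verdict; every
number certified (two lineages + referee) or labelled float. Crew hubbard-obs (D-0042), seat hubbard-obs-p1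
(`prover-hubbard-obs-p1-g0-0`). Theorem-only; zero compute; no named fact; no `sorry`. Part 1
(`Observables/PairLROTorusDictionary.lean`) proves the torus dictionary and the kinematic domination
`|B|² · L⁻⁴ · Re⟨ψ, Δ_d† Δ_d ψ⟩ ≤ Re ω̄_ψ(Γ(ι_{Λ_B,L}) pairBoxWord B)`; here:

* §3 CERTIFICATE (λ-form, `λ < 0`, finite torus, signed slack kept): for every `L ≥ 3` (window fits) and
  every unit `ψ ∈ (2n_h, S^z = 0)` with `Hψ = Eψ`,
  `|B|² L⁻⁴ Re⟨ψ, Δ_d†Δ_d ψ⟩ ≤ (hi − E_cert + Σ‖aₖ‖ − (Σμ)(n_h/L² − ν) − (hi − E/L²))/(−λ)`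
  (`sq_card_mul_pairFieldDensity_le_of_lambda_certificate_torus`; the tree's finite-torus window theorem
  `re_orbitState_ge_of_window_certificate_d4_TT'_ineq` read through the λ-form relabelling);
* §4 SUMMIT FORMAT: along the sector ground states `ψ_L ∈ (rectN n L, S^z = 0)` of `hubbardTorusTT' L 1 tp U`
  (`U ≥ 0`, `0 ≤ n < 2`), `E_L/L² → energyDensityTT' 1 tp U n ≤ hi` makes the slack eventually harmless, and
  with `torusLROSeq_pairFieldCorr_succ` the summit's own sequence obeys
  **`liminf_k |Λ_{2k}|⁻² Σ_{x,y∈Λ_{2k}} P_d(2k; x, y) ≤ (hi − E_cert + Σ‖aₖ‖ − (Σμ)(n/2 − ν))/((−λ)|B|²)`**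
  (`liminf_dWavePairFieldLRO_le_of_lambda_certificate`) — at `tp = 0`, `n = 1 − δ` this is LITERALLY the
  sequence whose positive `liminf` the summit `HubbardSuperconductivity` asserts (for its `U, δ`), read for
  ANY hypothesis-satisfying family `ψ` (we bound the liminf over all `k ≥ 1`, even and odd sides alike).
HONEST: a certified CEILING on the summit's LRO sequence at one `(U, n, t′)`; it neither proves nor refutes
the summit (which asserts `liminf > 0` for SOME `U, δ`); no number lives in this file.
-/

noncomputable section

namespace Summit.Ventures.CertifiedManyBodySolver.Observables

open Matrix Finset Literature.MathematicalPhysics.QuantumLattice Literature.Probability.LatticeModels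
open Literature.MathematicalPhysics.QuantumLattice.HubbardWave0 ThermodynamicLimit Filter Topology
open Literature.MathematicalPhysics.QuantumManyBody.StateRelaxation
open scoped ComplexOrder BigOperators

/-! ## §3  The λ-form certificate on a finite torus (signed slack kept) -/

section Certificate

variable {L : ℕ} [NeZero L]

/-- (Local to this section.) [folklore] -/
local instance (priority := high) instDecidableEqFermionTorusPairLRO'' : DecidableEq (FermionTorus 2 L) :=
  LinearOrder.toDecidableEq

/-- The λ-form relabelling identity (as in `Rows/DopedTLCorrLambda.lean`). -/
private theorem lambda_identity_eq_window_identity'' {M : Type*} [AddCommGroup M] [Module ℂ M]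
    (O E one D : M) (lam Ecert hi : ℝ) :
    ((lam : ℝ) : ℂ) • O - (((Ecert - hi : ℝ)) : ℂ) • one - D -
        (((1 : ℝ)) : ℂ) • ((((hi : ℝ)) : ℂ) • one - E) =
      ((lam : ℝ) : ℂ) • O + E - ((Ecert : ℝ) : ℂ) • one - D := by
  push_cast
  module

/-- **λ-form certificate (`λ < 0`) on a finite torus ⇒ ceiling on the pair-field density of every sector
eigenvector, with the energy slack explicit.** Data: a `D₄`-labelled (`γₗ ∈ S ∋ 1`, `S` closed) window
identity in λ-form for the objective `Γ(incl)(pairBoxWord S_d g_d B)` (`Λ_B ⊆ Λ'`), on a torus of side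
`L ≥ 3` on which `thicken Λ' 1` fits; then for every unit `ψ ∈ (2n_h, S^z = 0)` with
`hubbardTorusTT' L t t' U ψ = E ψ`:
`|B|² · L⁻⁴ Re⟨ψ, Δ_d†Δ_d ψ⟩ ≤ (hi − E_cert + Σ‖aₖ‖ − (Σμ)(n_h/L² − ν) − (hi − E/L²))/(−λ)`.
[cite: WangEtAl2024, §III] -/
theorem sq_card_mul_pairFieldDensity_le_of_lambda_certificate_torus (t t' U : ℝ) (hL : 3 ≤ L) {nh : ℕ}
    {lam : ℝ} (hlam : lam < 0) {hi Ecert : ℝ} {B : Finset (Site 2)}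
    {Λ Λ' : Finset (Site 2)} (hΛ : Λ ⊆ Λ') (h8 : thicken Λ 1 ⊆ Λ')
    (h0 : thicken ({0} : Finset (Site 2)) 1 ⊆ Λ') (hz : (0 : Site 2) ∈ Λ')
    (hB : B.biUnion (pairRegion (insert (0 : Site 2) unitSteps)) ⊆ Λ')
    (hInj : Set.InjOn (Torus.proj (d := 2) L) ↑(thicken Λ' 1))
    (hInj' : Set.InjOn (Torus.proj (d := 2) L) ↑Λ')
    {S : Finset (DihedralGroup 4)} (h1 : (1 : DihedralGroup 4) ∈ S) (hmul : ∀ a ∈ S, ∀ b ∈ S, a * b ∈ S)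
    {ψ : Fock (Orb (FermionTorus 2 L))}
    (hψK : ψ ∈ (szSector (2 * nh) 0 : Submodule ℂ (Fock (Orb (FermionTorus 2 L)))))
    (hψ1 : star ψ ⬝ᵥ ψ = 1) {E : ℝ} (hHψ : hubbardTorusTT' L t t' U *ᵥ ψ = (E : ℂ) • ψ)
    (μ : Fin 2 → ℝ) (ν : ℝ)
    {m : Type*} [Fintype m] [DecidableEq m] {Λm : Matrix m m ℂ} (hΛm : Λm.PosSemidef)
    (Og : m → FermionOp Λ')
    {κ' : Type*} (s : Finset κ') (Bk : κ' → FermionOp Λ)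
    {ι : Type*} (tt : Finset ι) (γ : ι → DihedralGroup 4) (hγS : ∀ l ∈ tt, γ l ∈ S) (wv : ι → Site 2)
    (hsh : ∀ l, d4ShiftSet (γ l) (wv l) Λ ⊆ Λ') (Y : ι → FermionOp Λ)
    {ρ : Type*} (uu : Finset ρ) (b : ρ → ℂ) (cw : ρ → List (Orb (PolySite Λ') × Bool))
    (hcw : ∀ j ∈ uu, ladderCharge (cw j) ≠ 0 ∨ ladderSpinCharge (cw j) ≠ 0)
    {δ : Type*} (ah : Finset δ) (dc : δ → ℝ) (V : δ → FermionOp Λ')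
    {κ'' : Type*} (w : Finset κ'') (a : κ'' → ℂ) (word : κ'' → List (Orb (PolySite Λ') × Bool))
    (hcert : ((lam : ℝ) : ℂ) • fermionEmbed (PolySite.incl hB) (pairBoxWord (insert (0 : Site 2) unitSteps) dWaveFormFactor B) +
        fermionEmbed (PolySite.incl h0) ((hubbardTTPrimeFermionInteraction t t' U).meanEnergyObs 1) -
        ((Ecert : ℝ) : ℂ) • (1 : FermionOp Λ') -
        ∑ σ : Fin 2, ((μ σ : ℝ) : ℂ) • (nAt 0 hz σ - ((ν : ℝ) : ℂ) • (1 : FermionOp Λ')) =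
      gramForm Λm Og +
        (∑ k ∈ s, ((hubbardTTPrimeFermionInteraction t t' U).localHamiltonian Λ' * fermionEmbed (PolySite.incl hΛ) (Bk k) -
            fermionEmbed (PolySite.incl hΛ) (Bk k) * (hubbardTTPrimeFermionInteraction t t' U).localHamiltonian Λ') +
          ∑ l ∈ tt, (fermionEmbed (PolySite.incl (hsh l)) (fermionEmbed (PolySite.d4Emb (γ l) (wv l) Λ) (Y l)) -
            fermionEmbed (PolySite.incl hΛ) (Y l)) +
          ∑ j ∈ uu, b j • ladderWord (cw j)) +
        (∑ m' ∈ ah, ((dc m' : ℝ) : ℂ) • ((V m')ᴴ - V m') + ∑ k ∈ w, a k • ladderWord (word k))) :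
    ((B.card : ℝ)) ^ 2 * ((expect ((pairField dWaveFormFactor L)ᴴ * pairField dWaveFormFactor L) ψ).re / (L : ℝ) ^ 4) ≤
      (hi - Ecert + ∑ k ∈ w, ‖a k‖ - (∑ σ : Fin 2, μ σ) * ((nh : ℝ) / (L : ℝ) ^ 2 - ν) -
        (hi - E / (L : ℝ) ^ 2)) / (-lam) := by
  set Ow : FermionOp Λ' := fermionEmbed (PolySite.incl hB) (pairBoxWord (insert (0 : Site 2) unitSteps) dWaveFormFactor B)
    with hOw
  have hcert' : ((lam : ℝ) : ℂ) • Ow - (((Ecert - hi : ℝ)) : ℂ) • (1 : FermionOp Λ') -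
      ∑ σ : Fin 2, ((μ σ : ℝ) : ℂ) • (nAt 0 hz σ - ((ν : ℝ) : ℂ) • (1 : FermionOp Λ')) -
      (((1 : ℝ)) : ℂ) • ((((hi : ℝ)) : ℂ) • (1 : FermionOp Λ') -
        fermionEmbed (PolySite.incl h0) ((hubbardTTPrimeFermionInteraction t t' U).meanEnergyObs 1)) =
      gramForm Λm Og +
        (∑ k ∈ s, ((hubbardTTPrimeFermionInteraction t t' U).localHamiltonian Λ' * fermionEmbed (PolySite.incl hΛ) (Bk k) -
            fermionEmbed (PolySite.incl hΛ) (Bk k) * (hubbardTTPrimeFermionInteraction t t' U).localHamiltonian Λ') +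
          ∑ l ∈ tt, (fermionEmbed (PolySite.incl (hsh l)) (fermionEmbed (PolySite.d4Emb (γ l) (wv l) Λ) (Y l)) -
            fermionEmbed (PolySite.incl hΛ) (Y l)) +
          ∑ j ∈ uu, b j • ladderWord (cw j)) +
        (∑ m' ∈ ah, ((dc m' : ℝ) : ℂ) • ((V m')ᴴ - V m') + ∑ k ∈ w, a k • ladderWord (word k)) := by
    rw [lambda_identity_eq_window_identity'']
    exact hcert
  have h := re_orbitState_ge_of_window_certificate_d4_TT'_ineq t t' U hL hΛ h8 h0 hz hInj hInj' h1 hmul hψK hψ1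
    hHψ (((lam : ℝ) : ℂ) • Ow) 1 hi μ ν hΛm Og s Bk tt γ hγS wv hsh Y uu b cw hcw ah dc V w a word hcert'
  -- the orbit state of `λ•Ow` is `λ ·` that of `Ow`, and `Γ(ι_{Λ'})(Γ(incl) W) = Γ(ι_{Λ_B}) W`
  have hInjB : Set.InjOn (Torus.proj (d := 2) L) ↑(B.biUnion (pairRegion (insert (0 : Site 2) unitSteps))) :=
    hInj'.mono (by exact_mod_cast hB)
  rw [fermionEmbed_smul, map_smul, smul_eq_mul, Complex.re_ofReal_mul, hOw,
    fermionEmbed_toTorusEmb_incl hB hInj'] at h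
  have hkin := sq_card_mul_pairFieldDensity_le_re_orbitState_pairBoxWord h1 B hInjB ψ
  have hneg : 0 < -lam := neg_pos.2 hlam
  rw [le_div_iff₀ hneg]
  nlinarith [h, hkin, hneg]

end Certificate

/-! ## §4  The summit's LRO sequence along sector ground states -/

section Summit

/-- **λ-form certificate ⇒ ceiling on the `liminf` of `HubbardSuperconductivity`'s LRO sequence.** Let a
`D₄`-labelled λ-form window certificate (`λ < 0`) for the box pair word `pairBoxWord S_d g_d B` be given (data
as in `sq_card_mul_pairFieldDensity_le_of_lambda_certificate_torus`, hoppings `1, tp`, coupling `U ≥ 0`),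
let `0 ≤ n < 2`, `energyDensityTT' 1 tp U n ≤ hi`, and let `ψ_L` be unit ground states of the sectors
`(rectN n L, S^z = 0)` of `hubbardTorusTT' L 1 tp U` (all `L`). Then the summit's sequence
`k ↦ |Λ_{2k}|⁻² Σ_{x,y∈Λ_{2k}} P_d(2k; x, y)` (`= (2k)⁻⁴ Re⟨ψ_{2k}, Δ_d†Δ_d ψ_{2k}⟩`) has
`liminf ≤ (hi − E_cert + Σ‖aₖ‖ − (Σμ)(n/2 − ν)) / ((−λ)|B|²)`. At `tp = 0`, `n = 1 − δ` this is the sequence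
of `Literature.Hubbard.DWaveSuperconductivityHubbard` read for the given family. [cite: Scalapino1995, §2 eq. (2.4)] -/
theorem liminf_dWavePairFieldLRO_le_of_lambda_certificate (tp : ℝ) {U : ℝ} (hU : 0 ≤ U) {n : ℝ}
    (hn0 : 0 ≤ n) (hn2 : n < 2) {lam : ℝ} (hlam : lam < 0) {hi Ecert : ℝ}
    (hhi : energyDensityTT' 1 tp U n ≤ hi) {B : Finset (Site 2)} (hBne : B.Nonempty)
    {Λ Λ' : Finset (Site 2)} (hΛ : Λ ⊆ Λ') (h8 : thicken Λ 1 ⊆ Λ')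
    (h0 : thicken ({0} : Finset (Site 2)) 1 ⊆ Λ') (hz : (0 : Site 2) ∈ Λ')
    (hB : B.biUnion (pairRegion (insert (0 : Site 2) unitSteps)) ⊆ Λ')
    {S : Finset (DihedralGroup 4)} (h1 : (1 : DihedralGroup 4) ∈ S) (hmul : ∀ a ∈ S, ∀ b ∈ S, a * b ∈ S)
    (μ : Fin 2 → ℝ) (ν : ℝ)
    {m : Type*} [Fintype m] [DecidableEq m] {Λm : Matrix m m ℂ} (hΛm : Λm.PosSemidef)
    (Og : m → FermionOp Λ')
    {κ' : Type*} (s : Finset κ') (Bk : κ' → FermionOp Λ)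
    {ι : Type*} (tt : Finset ι) (γ : ι → DihedralGroup 4) (hγS : ∀ l ∈ tt, γ l ∈ S) (wv : ι → Site 2)
    (hsh : ∀ l, d4ShiftSet (γ l) (wv l) Λ ⊆ Λ') (Y : ι → FermionOp Λ)
    {ρ : Type*} (uu : Finset ρ) (b : ρ → ℂ) (cw : ρ → List (Orb (PolySite Λ') × Bool))
    (hcw : ∀ j ∈ uu, ladderCharge (cw j) ≠ 0 ∨ ladderSpinCharge (cw j) ≠ 0)
    {δ : Type*} (ah : Finset δ) (dc : δ → ℝ) (V : δ → FermionOp Λ')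
    {κ'' : Type*} (w : Finset κ'') (a : κ'' → ℂ) (word : κ'' → List (Orb (PolySite Λ') × Bool))
    (hcert : ((lam : ℝ) : ℂ) • fermionEmbed (PolySite.incl hB) (pairBoxWord (insert (0 : Site 2) unitSteps) dWaveFormFactor B) +
        fermionEmbed (PolySite.incl h0) ((hubbardTTPrimeFermionInteraction 1 tp U).meanEnergyObs 1) -
        ((Ecert : ℝ) : ℂ) • (1 : FermionOp Λ') -
        ∑ σ : Fin 2, ((μ σ : ℝ) : ℂ) • (nAt 0 hz σ - ((ν : ℝ) : ℂ) • (1 : FermionOp Λ')) =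
      gramForm Λm Og +
        (∑ k ∈ s, ((hubbardTTPrimeFermionInteraction 1 tp U).localHamiltonian Λ' * fermionEmbed (PolySite.incl hΛ) (Bk k) -
            fermionEmbed (PolySite.incl hΛ) (Bk k) * (hubbardTTPrimeFermionInteraction 1 tp U).localHamiltonian Λ') +
          ∑ l ∈ tt, (fermionEmbed (PolySite.incl (hsh l)) (fermionEmbed (PolySite.d4Emb (γ l) (wv l) Λ) (Y l)) -
            fermionEmbed (PolySite.incl hΛ) (Y l)) +
          ∑ j ∈ uu, b j • ladderWord (cw j)) +
        (∑ m' ∈ ah, ((dc m' : ℝ) : ℂ) • ((V m')ᴴ - V m') + ∑ k ∈ w, a k • ladderWord (word k)))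
    (ψ : ∀ L, Fock (Orb (FermionTorus 2 L)))
    (hψ : ∀ L, IsGroundStateInSector (hubbardTorusTT' L 1 tp U) (rectN n L) 0 (ψ L))
    (hψ1 : ∀ L, star (ψ L) ⬝ᵥ ψ L = 1) :
    liminf (fun k : ℕ => (∑ x ∈ halfOpenBox 2 (2 * k), ∑ y ∈ halfOpenBox 2 (2 * k),
        torusPullback (pairFieldCorr dWaveFormFactor ψ) (2 * k) x y) /
          ((#(halfOpenBox 2 (2 * k)) : ℝ)) ^ 2) atTop ≤
      (hi - Ecert + ∑ k ∈ w, ‖a k‖ - (∑ σ : Fin 2, μ σ) * (n / 2 - ν)) / ((-lam) * ((B.card : ℝ)) ^ 2) := by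
  set C : ℝ := (hi - Ecert + ∑ k ∈ w, ‖a k‖ - (∑ σ : Fin 2, μ σ) * (n / 2 - ν)) / ((-lam) * ((B.card : ℝ)) ^ 2)
    with hC
  set u : ℕ → ℝ := fun k => (∑ x ∈ halfOpenBox 2 (2 * k), ∑ y ∈ halfOpenBox 2 (2 * k),
      torusPullback (pairFieldCorr dWaveFormFactor ψ) (2 * k) x y) /
        ((#(halfOpenBox 2 (2 * k)) : ℝ)) ^ 2 with hu
  change liminf u atTop ≤ C
  have hneg : 0 < -lam := neg_pos.2 hlam
  have hBpos : 0 < ((B.card : ℝ)) ^ 2 := by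
    have : 0 < (B.card : ℝ) := by exact_mod_cast hBne.card_pos
    positivity
  -- the `k`-th term (for `k ≥ 1`) is the pair-field density of `ψ_{2k}` (`2k = n + 1`)
  have hterm : ∀ k : ℕ, 1 ≤ k → ∃ n : ℕ, 2 * k = n + 1 ∧
      u k = (expect ((pairField dWaveFormFactor (n + 1))ᴴ * pairField dWaveFormFactor (n + 1)) (ψ (n + 1))).re /
        (((n + 1 : ℕ) : ℝ)) ^ 4 := by
    intro k hk
    refine ⟨2 * k - 1, by omega, ?_⟩
    have e : 2 * k = (2 * k - 1) + 1 := by omega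
    simp only [hu]
    rw [e, torusLROSeq_pairFieldCorr_succ]
    rfl
  have hnonneg : ∀ k : ℕ, 1 ≤ k → 0 ≤ u k := by
    intro k hk
    obtain ⟨n, -, hn⟩ := hterm k hk
    rw [hn]
    refine div_nonneg ?_ (by positivity)
    exact (posSemidef_conjTranspose_mul_self (pairField dWaveFormFactor (n + 1))).re_dotProduct_nonneg (ψ (n + 1))
  have hbdd : IsBoundedUnder (· ≥ ·) atTop u :=
    isBoundedUnder_of_eventually_ge (a := 0) (Filter.eventually_atTop.2 ⟨1, fun k hk => hnonneg k hk⟩)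
  -- along `L = 2k`: energies per site → `e ≤ hi`, fillings → `n/2`
  have hL2 : Tendsto (fun k : ℕ => 2 * k) atTop atTop :=
    Filter.tendsto_id.const_mul_atTop' (by norm_num)
  have hE : Tendsto (fun k : ℕ => groundEnergy (hubbardTorusTT' (2 * k) 1 tp U) (rectN n (2 * k)) /
      (((2 * k : ℕ) : ℝ)) ^ 2) atTop (𝓝 (energyDensityTT' 1 tp U n)) :=
    (tendsto_energyDensityTT'_torus 1 tp hU hn0 hn2).comp hL2
  have hN : Tendsto (fun k : ℕ => (rectN n (2 * k) : ℝ) / 2 / (((2 * k : ℕ) : ℝ)) ^ 2) atTop (𝓝 (n / 2)) := by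
    have h := ((tendsto_rectN_div_sq hn0).comp hL2).div_const 2
    refine h.congr fun k => ?_
    simp only [Function.comp_apply]
    ring
  -- the finite-torus ceiling with slack, as a sequence in `k`
  set bound : ℕ → ℝ := fun k => (hi - Ecert + ∑ k ∈ w, ‖a k‖ -
      (∑ σ : Fin 2, μ σ) * ((rectN n (2 * k) : ℝ) / 2 / (((2 * k : ℕ) : ℝ)) ^ 2 - ν) -
      (hi - groundEnergy (hubbardTorusTT' (2 * k) 1 tp U) (rectN n (2 * k)) / (((2 * k : ℕ) : ℝ)) ^ 2)) /
        ((-lam) * ((B.card : ℝ)) ^ 2) with hbound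
  have hslack : Tendsto bound atTop
      (𝓝 ((hi - Ecert + ∑ k ∈ w, ‖a k‖ - (∑ σ : Fin 2, μ σ) * (n / 2 - ν) -
        (hi - energyDensityTT' 1 tp U n)) / ((-lam) * ((B.card : ℝ)) ^ 2))) :=
    (((tendsto_const_nhds.sub ((hN.sub_const ν).const_mul _)).sub (tendsto_const_nhds.sub hE)).div_const _)
  have hev : ∀ᶠ k : ℕ in atTop, u k ≤ bound k := by
    filter_upwards [(eventually_injOn_proj_of_tendsto (thicken Λ' 1) hL2), hL2.eventually_ge_atTop 3,
      Filter.eventually_ge_atTop 1] with k hInj hL3 hk1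
    obtain ⟨N, hN2k, hterm'⟩ := hterm k hk1
    rw [hterm', hbound]
    dsimp only
    rw [hN2k] at hInj hL3 ⊢
    have hInj' : Set.InjOn (Torus.proj (d := 2) (N + 1)) ↑Λ' := hInj.mono (by exact_mod_cast subset_thicken Λ' 1)
    set nh : ℕ := ⌊n * (((N + 1 : ℕ) : ℝ)) ^ 2 / 2⌋₊ with hnh
    have hrect : rectN n (N + 1) = 2 * nh := rfl
    obtain ⟨hψK, -, hHψ⟩ := hψ (N + 1)
    rw [hrect] at hψK hHψ
    have hnle : nh ≤ Fintype.card (FermionTorus 2 (N + 1)) := by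
      have h := rectN_le_two_mul hn0 hn2.le (N + 1)
      rw [hrect] at h
      have hc : Fintype.card (FermionTorus 2 (N + 1)) = (N + 1) * (N + 1) := by simp [FermionTorus, sq]
      rw [hc]
      omega
    rw [← groundEnergy_hubbardTorusTT'_eq_minEnergyOn_szSector (N + 1) 1 tp U hnle] at hHψ
    have hfin := sq_card_mul_pairFieldDensity_le_of_lambda_certificate_torus (hi := hi) 1 tp U hL3 hlam hΛ h8 h0 hz hB
      hInj hInj' h1 hmul hψK (hψ1 (N + 1)) hHψ μ ν hΛm Og s Bk tt γ hγS wv hsh Y uu b cw hcw ah dc V w a word hcert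
    have hcast : (nh : ℝ) = (rectN n (N + 1) : ℝ) / 2 := by rw [hrect]; push_cast; ring
    rw [hcast, ← hrect] at hfin
    rw [le_div_iff₀ (mul_pos hneg hBpos)]
    have h2 := (le_div_iff₀ hneg).1 hfin
    nlinarith [h2, hBpos]
  -- pass to the limit: `liminf u ≤ lim bound ≤ C`
  have hlim_le : (hi - Ecert + ∑ k ∈ w, ‖a k‖ - (∑ σ : Fin 2, μ σ) * (n / 2 - ν) -
      (hi - energyDensityTT' 1 tp U n)) / ((-lam) * ((B.card : ℝ)) ^ 2) ≤ C := by
    rw [hC]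
    exact div_le_div_of_nonneg_right (by linarith) (mul_pos hneg hBpos).le
  have hll : liminf u atTop ≤ liminf bound atTop := Filter.liminf_le_liminf hev hbdd hslack.isCoboundedUnder_ge
  rw [hslack.liminf_eq] at hll
  exact hll.trans hlim_le

end Summit

end Summit.Ventures.CertifiedManyBodySolver.Observables

end
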